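import Summits.HodgeConjecture.CorCM.MultiFieldWeilParts
import Summits.HodgeConjecture.CorCM.OcticWeilMultiFourfoldParts
import Summits.HodgeConjecture.CorCM.CMWeilSectionEndomorphism
import Literature.AlgebraicGeometry.HodgeTheory.AbelianVarietyEndomorphismsHOne
import Literature.AlgebraicGeometry.HodgeTheory.WeilClassesCyclicPrymTyping
import HarnessLib

/-!
# MULTI-FIELD WEIL ENGINE — the Weil-space input `hW` for a slot of CURVE MULTIPLICITY `c = 0`: an OCTIC `(2,2)`-slot, whose single-slot Weil part is the
# CM fourfold of WEIL TYPE `B_m` ITSELF (the one-slot product `⨁_{Fin 1} B_m`), from Markman's FOURFOLD theorem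

Cell `pub-hodgecm2` (COR-CM), seat b30 gen 29 (2026-08-24); count-neutral own lane MULTI-FIELD WEIL ENGINE (stem `MultiFieldWeil*`), the `c = 0` companion of
gen 28ʼs `CorCM/MultiFieldWeilMarkman.lean` (`c = 1, 2, 1` suppliers).  Theorems only; no definition, no named fact of its own, no `sorry`.  HONEST FRAMING:
everything is CONDITIONAL on the displayed named fact `HodgeTheory.Markman2025_weilClasses_algebraic_abelianFourfold` (unrefereed); `HC_CM` is NOT asserted.

THE POINT.  The generic headline `MultiFieldWeil.hodgeConjectureFor_biproduct_comp_of_defectLawG` asks, for each slot `m`, for the complex Weil PLANE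
`weilClassesOf (⨁_i A(partSlots (c m) m i)) (⊕ ι(δ)) (w m) d` to be algebraic.  For an octic field `K_m ⊇ i_m(k)` and a type of `k`-signature `(2,2)` the curve
multiplicity is `c = 4 − 2·2 = 0`: the part is `⨁_{Fin 1} B_m`, a CM abelian FOURFOLD of Weil type for `(k, ι(i_m δ))`.  Its plane `E₊ ⊕ E₋` is handled
line by line: `E₊ = ⋀⁴ H¹(B_m)_{τp}` (`τp(δ) = i√d`) CONTAINS the weight line `H⁴_{S₊}` of the weight `S₊ = {(0, s) | s ∘ i_m = τp}`
(`PairWeights.weightClassesAlg_le_weilClassesPlus`), which is NON-ZERO (cup monomial of an eigenbasis, `Pohlmann1968.weightClassesAlg_eq_span_singleton`) and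
ALGEBRAIC given Markman (`CMWeights.weightClassesAlg_le_algebraicClasses_two_of_markman`: total dimension `4`, `S₊` balanced by the type count
`#{s ∈ Φ | s ∘ i_m = τ'} = 2`); `E₊` is a line (`weilClassesPlus_le_span_singleton`, `H• = ⋀• H¹`, `b₁ = 8`), so `E₊ ≤ alg`, and `E₋ = conj E₊`
(`weilClassesOf_le_algebraicClasses_of_weilClassesPlus_le`).
* §1 `sigmaMk_one_injective22`, `weilWeight_mem_pohlmannSetsAlg22`, `dim_biproduct_one_eq_four22`, `weightClassesAlg_weilWeight_le_algebraicClasses_of_markman22` —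
  gen 25ʼs `OcticWeilMulti.…O` lemmas re-instantiated for the slot family `mfSlots i₀ is` of the generic engine;
* §2 **`weilClassesOf_one_le_algebraicClasses_of_markman22`** (the plane of `⨁_{Fin 1} B_m`, intrinsic type count) and the ENGINE INPUT
  **`weilHyp_of_markman_fourfold22`** (frame reading at `{0, 1}`, family `partSlots 0 m` via `weilHyp_transport`).
[cite: Markman2025SurveySecant, Thm. 1.2 and §1.1] [cite: vanGeemen1994HodgeAV, 4.9 and proof of Thm. 6.12] [cite: Deligne1982HodgeCycles, §4 Prop. 4.4]
[cite: MoonenZarhin1995Duke, Thm. 2.4] [cite: Milne2020HodgeClassesAV, 1.2 (a)]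

## References
* [Markman2025SurveySecant] E. Markman, arXiv:2509.23403, Thm. 1.2, §1.1.  [vanGeemen1994HodgeAV] B. van Geemen, LNM 1594, 4.9–4.10, Lemma 5.2, Thm. 6.12.
  [Deligne1982HodgeCycles] P. Deligne, LNM 900 (1982), §4 Prop. 4.4.  [MoonenZarhin1995Duke] B. Moonen, Yu. Zarhin, Duke Math. J. 77 (1995), Thm. 2.4.
  [Milne2020HodgeClassesAV] J. S. Milne, arXiv:2010.08857, 1.2 (a), Thm. 1.
-/

noncomputable section

open CategoryTheory CategoryTheory.Limits NumberField

namespace Summit.HodgeConjecture.CorCM.MultiFieldWeil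

open Literature.AlgebraicGeometry Literature.AlgebraicGeometry.Motives Literature.AlgebraicGeometry.HodgeTheory
open Literature.AlgebraicGeometry.ComplexMultiplication (IsCMTypeRealisation)
open Literature.AlgebraicGeometry.Pohlmann1968
open Literature.AlgebraicTopology.SingularHomology
open Literature.NumberTheory.ComplexMultiplication
open Summit.HodgeConjecture.CorCM.OcticCurveFourfold (card_filter_comp_eq_four)
open Summit.HodgeConjecture.CorCM.OcticWeilFourfold (card_filter_comp_eq_and_comp_mem_eq)
open Summit.HodgeConjecture.CorCM.OcticWeilMulti (typeCount_eq_two_of_frameO)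
open Summit.HodgeConjecture.CorCM.CMWeights (weightClassesAlg_le_algebraicClasses_two_of_markman sum_finrank_eq_two_mul_dim
  biproduct_map_comp_self_eq_neg)
open Summit.HodgeConjecture.CorCM.PairWeights (weightClassesAlg_le_weilClassesPlus)
open Summit.HodgeConjecture.CorCM.DihedralSexticPairCurvePowers (ncard_sep_eq_card_filter)

open scoped Classical

variable {I : Type} {r : ℕ} {Kf : I → Type} [∀ i, Field (Kf i)] [∀ i, NumberField (Kf i)] [∀ i, IsCMField (Kf i)]
  {i₀ : I} {is : Fin r → I} {τ : Kf i₀ →+* ℂ} {im : ∀ m : Fin r, Kf i₀ →+* Kf (is m)}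
  {A : Fin (r + 1) → AbelianVariety ℂ} {Φ : ∀ j : Fin (r + 1), CMType (Kf (mfSlots i₀ is j))}
  {ι : ∀ j, 𝓞 (Kf (mfSlots i₀ is j)) →+* End (A j)}
  {θ : ∀ j, Kf (mfSlots i₀ is j) →+* Module.End ℂ (complexBetti (A j).X 1)}
  {δ : 𝓞 (Kf i₀)} {d : ℕ}

/-! ## §1 The Weil weight of the one-slot product `⨁_{Fin 1} B_m` is balanced and algebraic given Markman -/

omit [∀ i, NumberField (Kf i)] [∀ i, IsCMField (Kf i)] in
/-- The index map `s ↦ (0, s)` into the index set of the one-slot product `⨁_{Fin 1} B_m` is injective. [folklore] -/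
theorem sigmaMk_one_injective22 (m : Fin r) : Function.Injective fun s : Kf (is m) →+* ℂ =>
    (⟨(0 : Fin 1), s⟩ : (j : Fin 1) × (Kf (mfSlots i₀ is ((fun _ : Fin 1 => m.succ) j)) →+* ℂ)) :=
  fun s s' h => by cases h; rfl

omit [∀ i, IsCMField (Kf i)] in
/-- **THE WEIL WEIGHT of `⨁_{Fin 1} B_m` is `Aut(ℂ)`-balanced**: the weight `{(0, s) | s ∘ i_m = τ₁}` (of the Weil line `⋀⁴ H¹(B_m)_{τ₁}`) lies in
`pohlmannSetsAlg _ 2`, from the TYPE COUNT `#{s ∈ Φ_(m+1) | s ∘ i_m = τ'} = 2` alone — no Galois hypothesis (gen 25ʼs `OcticWeilMulti.weilWeight_mem_pohlmannSetsAlgO`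
for the slot family of the generic engine). [cite: Deligne1982HodgeCycles, §4 Prop. 4.4] [cite: MoonenZarhin1995Duke, Thm. 2.4] -/
theorem weilWeight_mem_pohlmannSetsAlg22 (m : Fin r) (h8 : Module.finrank ℚ (Kf (is m)) = 8) (h2 : Module.finrank ℚ (Kf i₀) = 2)
    (hcount : ∀ τ' : Kf i₀ →+* ℂ,
      (Finset.univ.filter fun s : Kf (is m) →+* ℂ => s.comp (im m) = τ' ∧ s ∈ (Φ m.succ).1).card = 2)
    (τ₁ : Kf i₀ →+* ℂ) :
    ((Finset.univ.filter fun s : Kf (is m) →+* ℂ => s.comp (im m) = τ₁).image fun s : Kf (is m) →+* ℂ =>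
        (⟨(0 : Fin 1), s⟩ : (j : Fin 1) × (Kf (mfSlots i₀ is ((fun _ : Fin 1 => m.succ) j)) →+* ℂ))) ∈
      pohlmannSetsAlg (K := fun j : Fin 1 => Kf (mfSlots i₀ is ((fun _ : Fin 1 => m.succ) j)))
        (fun j => Φ ((fun _ : Fin 1 => m.succ) j)) 2 := by
  have h4 : ∀ τ' : Kf i₀ →+* ℂ, (Finset.univ.filter fun s : Kf (is m) →+* ℂ => s.comp (im m) = τ').card = 4 :=
    card_filter_comp_eq_four (im m) h8 h2
  have hci := Finset.card_image_of_injective (Finset.univ.filter fun s : Kf (is m) →+* ℂ => s.comp (im m) = τ₁)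
    (sigmaMk_one_injective22 (i₀ := i₀) (is := is) m)
  refine ⟨by rw [hci, h4 τ₁], fun ρ => ?_⟩
  rw [ncard_sep_eq_card_filter, ncard_sep_eq_card_filter, Finset.filter_image, Finset.filter_image,
    Finset.card_image_of_injective _ (sigmaMk_one_injective22 (i₀ := i₀) (is := is) m),
    Finset.card_image_of_injective _ (sigmaMk_one_injective22 (i₀ := i₀) (is := is) m), Finset.filter_filter,
    Finset.filter_filter]
  obtain ⟨hin, hout⟩ := card_filter_comp_eq_and_comp_mem_eq (im m) (Φ m.succ).1 h4 hcount ρ τ₁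
  exact hin.trans hout.symm

omit [∀ i, IsCMField (Kf i)] in
/-- The one-slot product `⨁_{Fin 1} B_m` has dimension `4` (`[K_m:ℚ] = 8`). [folklore] -/
theorem dim_biproduct_one_eq_four22 (m : Fin r) (hA : ∀ j, IsCMTypeRealisation (Φ j) (A j) (ι j) (θ j))
    (h8 : Module.finrank ℚ (Kf (is m)) = 8) :
    (⨁ fun j : Fin 1 => A ((fun _ : Fin 1 => m.succ) j)).dim = 4 := by
  have h := sum_finrank_eq_two_mul_dim (K := fun j : Fin 1 => Kf (mfSlots i₀ is ((fun _ : Fin 1 => m.succ) j)))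
    (fun j => hA ((fun _ : Fin 1 => m.succ) j))
  rw [Fin.sum_univ_one] at h
  change Module.finrank ℚ (Kf (is m)) = _ at h
  omega

/-- **The Weil weight of `⨁_{Fin 1} B_m` over `τ₁` has an algebraic line, GIVEN Markman's fourfold theorem**: dimension `4` and balanced, so the cellʼs
`CMWeights.weightClassesAlg_le_algebraicClasses_two_of_markman` applies. [cite: Markman2025SurveySecant, Thm. 1.2 and §1.1] [cite: MoonenZarhin1995Duke, Thm. 2.4] -/
theorem weightClassesAlg_weilWeight_le_algebraicClasses_of_markman22 (hW4 : Markman2025_weilClasses_algebraic_abelianFourfold) (m : Fin r)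
    (hA : ∀ j, IsCMTypeRealisation (Φ j) (A j) (ι j) (θ j)) (h8 : Module.finrank ℚ (Kf (is m)) = 8) (h2 : Module.finrank ℚ (Kf i₀) = 2)
    (hcount : ∀ τ' : Kf i₀ →+* ℂ,
      (Finset.univ.filter fun s : Kf (is m) →+* ℂ => s.comp (im m) = τ' ∧ s ∈ (Φ m.succ).1).card = 2)
    (τ₁ : Kf i₀ →+* ℂ) :
    weightClassesAlg (fun j : Fin 1 => A ((fun _ : Fin 1 => m.succ) j))
        (fun j => ι ((fun _ : Fin 1 => m.succ) j)) (2 * 2)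
        ((Finset.univ.filter fun s : Kf (is m) →+* ℂ => s.comp (im m) = τ₁).image fun s : Kf (is m) →+* ℂ =>
          (⟨(0 : Fin 1), s⟩ : (j : Fin 1) × (Kf (mfSlots i₀ is ((fun _ : Fin 1 => m.succ) j)) →+* ℂ))) ≤
      algebraicClasses (⨁ fun j : Fin 1 => A ((fun _ : Fin 1 => m.succ) j)).X 2 :=
  weightClassesAlg_le_algebraicClasses_two_of_markman hW4 (fun j => hA ((fun _ : Fin 1 => m.succ) j))
    (dim_biproduct_one_eq_four22 m hA h8) (weilWeight_mem_pohlmannSetsAlg22 m h8 h2 hcount τ₁)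

/-! ## §2 The Weil plane of `⨁_{Fin 1} B_m` for `φ = ι(i_m δ)` is algebraic given Markman: the engine input for `c = 0` -/

/-- **The WHOLE WEIL PLANE of the one-slot product `⨁_{Fin 1} B_m`, for the endomorphism `ι_{B_m}(i_m δ)` (`δ² = −d`), is algebraic GIVEN Markman's
fourfold theorem** — `k`-signature `(2,2)` given as the intrinsic type count `#{s ∈ Φ_(m+1) | s ∘ i_m = τ'} = 2`.  Proof in the module docstring: `E₊ ⊇ H⁴_{S₊} ∋
w_{S₊} ≠ 0` algebraic, `dim E₊ = 1`, `E₋ = conj E₊`. [cite: Markman2025SurveySecant, Thm. 1.2 and §1.1] [cite: vanGeemen1994HodgeAV, 4.9 and proof of Thm. 6.12]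
[cite: Milne2020HodgeClassesAV, 1.2 (a)] -/
theorem weilClassesOf_one_le_algebraicClasses_of_markman22 (hW4 : Markman2025_weilClasses_algebraic_abelianFourfold) (m : Fin r)
    (h8 : Module.finrank ℚ (Kf (is m)) = 8) (h2 : Module.finrank ℚ (Kf i₀) = 2) (hd : 0 < d) (hδ : ((δ : Kf i₀)) ^ 2 = -(d : Kf i₀))
    (hA : ∀ j, IsCMTypeRealisation (Φ j) (A j) (ι j) (θ j))
    (hcount : ∀ τ' : Kf i₀ →+* ℂ,
      (Finset.univ.filter fun s : Kf (is m) →+* ℂ => s.comp (im m) = τ' ∧ s ∈ (Φ m.succ).1).card = 2) :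
    weilClassesOf (⨁ fun j : Fin 1 => A ((fun _ : Fin 1 => m.succ) j))
        (biproduct.map fun j : Fin 1 => ι ((fun _ : Fin 1 => m.succ) j) (δfam im δ ((fun _ : Fin 1 => m.succ) j))) 2 d ≤
      algebraicClasses (⨁ fun j : Fin 1 => A ((fun _ : Fin 1 => m.succ) j)).X 2 := by
  have hA' : ∀ j : Fin 1, IsCMTypeRealisation (Φ ((fun _ : Fin 1 => m.succ) j)) (A ((fun _ : Fin 1 => m.succ) j))
      (ι ((fun _ : Fin 1 => m.succ) j)) (θ ((fun _ : Fin 1 => m.succ) j)) := fun j => hA _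
  -- the eigen-data `a = (i_m δ)` and `φ² = −d`
  let a : ∀ j : Fin 1, 𝓞 (Kf (mfSlots i₀ is ((fun _ : Fin 1 => m.succ) j))) := fun j => δfam im δ ((fun _ : Fin 1 => m.succ) j)
  have hδ𝓞 : δ ^ 2 = -(d : 𝓞 (Kf i₀)) := by
    apply RingOfIntegers.ext
    change algebraMap (𝓞 (Kf i₀)) (Kf i₀) (δ ^ 2) = algebraMap (𝓞 (Kf i₀)) (Kf i₀) (-(d : 𝓞 (Kf i₀)))
    rw [map_pow, map_neg, map_natCast]
    exact hδ
  have ha : ∀ j, a j * a j = -(d : 𝓞 (Kf (mfSlots i₀ is ((fun _ : Fin 1 => m.succ) j)))) := by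
    intro j
    change RingOfIntegers.mapRingHom (im m) δ * RingOfIntegers.mapRingHom (im m) δ = -(d : 𝓞 (Kf (is m)))
    rw [← map_mul, ← sq, hδ𝓞, map_neg, map_natCast]
  have hφ : (biproduct.map fun j : Fin 1 => ι ((fun _ : Fin 1 => m.succ) j) (a j)) ≫
      (biproduct.map fun j : Fin 1 => ι ((fun _ : Fin 1 => m.succ) j) (a j)) =
      -(d • 𝟙 (⨁ fun j : Fin 1 => A ((fun _ : Fin 1 => m.succ) j))) :=
    biproduct_map_comp_self_eq_neg (A := fun j : Fin 1 => A ((fun _ : Fin 1 => m.succ) j)) (ι := fun j => ι ((fun _ : Fin 1 => m.succ) j)) a ha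
  -- the embedding `τp` with `τp(δ) = i√d` and the weight `S₊` over it
  obtain ⟨τp, hτp⟩ := WeilFourfold.exists_apply_eq_I_mul_sqrt hδ
  set S : Finset ((j : Fin 1) × (Kf (mfSlots i₀ is ((fun _ : Fin 1 => m.succ) j)) →+* ℂ)) :=
    (Finset.univ.filter fun s : Kf (is m) →+* ℂ => s.comp (im m) = τp).image fun s : Kf (is m) →+* ℂ =>
      (⟨(0 : Fin 1), s⟩ : (j : Fin 1) × (Kf (mfSlots i₀ is ((fun _ : Fin 1 => m.succ) j)) →+* ℂ)) with hSdef
  have hScard : S.card = 2 * 2 := by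
    rw [hSdef, Finset.card_image_of_injective _ (sigmaMk_one_injective22 (i₀ := i₀) (is := is) m), card_filter_comp_eq_four (im m) h8 h2 τp]
  have hSval : ∀ z ∈ S, z.2 ((a z.1 : 𝓞 (Kf (mfSlots i₀ is ((fun _ : Fin 1 => m.succ) z.1)))) :
      Kf (mfSlots i₀ is ((fun _ : Fin 1 => m.succ) z.1))) = Complex.I * (Real.sqrt d : ℂ) := by
    intro z hz
    obtain ⟨s, hs, rfl⟩ := Finset.mem_image.1 hz
    have hs' : s.comp (im m) = τp := (Finset.mem_filter.1 hs).2
    change s ((RingOfIntegers.mapRingHom (im m) δ : 𝓞 (Kf (is m))) : Kf (is m)) = _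
    rw [RingOfIntegers.mapRingHom_apply, ← RingHom.comp_apply, hs', hτp]
  -- the weight line: inside `E₊`, algebraic, spanned by a non-zero cup monomial
  have hline_plus : weightClassesAlg (fun j : Fin 1 => A ((fun _ : Fin 1 => m.succ) j)) (fun j => ι ((fun _ : Fin 1 => m.succ) j)) (2 * 2) S ≤
      weilClassesPlus (⨁ fun j : Fin 1 => A ((fun _ : Fin 1 => m.succ) j))
        (biproduct.map fun j : Fin 1 => ι ((fun _ : Fin 1 => m.succ) j) (a j)) 2 d :=
    weightClassesAlg_le_weilClassesPlus a hScard hSval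
  have hline_alg : weightClassesAlg (fun j : Fin 1 => A ((fun _ : Fin 1 => m.succ) j)) (fun j => ι ((fun _ : Fin 1 => m.succ) j)) (2 * 2) S ≤
      algebraicClasses (⨁ fun j : Fin 1 => A ((fun _ : Fin 1 => m.succ) j)).X 2 :=
    weightClassesAlg_weilWeight_le_algebraicClasses_of_markman22 hW4 m hA h8 h2 hcount τp
  letI : LinearOrder ((j : Fin 1) × (Kf (mfSlots i₀ is ((fun _ : Fin 1 => m.succ) j)) →+* ℂ)) :=
    LinearOrder.lift' (Fintype.equivFin _) (Fintype.equivFin _).injective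
  obtain ⟨w, hw, -, -⟩ := exists_eigenbasis_biproduct hA'
  obtain ⟨b, hb⟩ := exists_monomialBasis w (2 * 2)
  have hb' : ∀ s, b s = cupMonomial w (2 * 2) s := fun s => hb s
  let u : Set.powersetCard ((j : Fin 1) × (Kf (mfSlots i₀ is ((fun _ : Fin 1 => m.succ) j)) →+* ℂ)) (2 * 2) := Set.powersetCard.ofCard hScard
  have hline : weightClassesAlg (fun j : Fin 1 => A ((fun _ : Fin 1 => m.succ) j)) (fun j => ι ((fun _ : Fin 1 => m.succ) j)) (2 * 2) S = ℂ ∙ b u :=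
    weightClassesAlg_eq_span_singleton hw hb' u
  have hbu : b u ∈ weightClassesAlg (fun j : Fin 1 => A ((fun _ : Fin 1 => m.succ) j)) (fun j => ι ((fun _ : Fin 1 => m.succ) j)) (2 * 2) S := by
    rw [hline]; exact Submodule.mem_span_singleton_self _
  -- `E₊` is the line of `b u`, hence algebraic; `E₋` by conjugation
  have hΛ := Motives.AbelianVariety.hasExteriorCohomologyH1_complexPoints (⨁ fun j : Fin 1 => A ((fun _ : Fin 1 => m.succ) j))
  have hb₁ : Module.finrank ℂ (complexBetti (⨁ fun j : Fin 1 => A ((fun _ : Fin 1 => m.succ) j)).X 1) = 2 * (2 * 2) := by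
    rw [Motives.AbelianVariety.finrank_complexBetti_one, dim_biproduct_one_eq_four22 m hA h8]
  have hplus : weilClassesPlus (⨁ fun j : Fin 1 => A ((fun _ : Fin 1 => m.succ) j))
      (biproduct.map fun j : Fin 1 => ι ((fun _ : Fin 1 => m.succ) j) (a j)) 2 d ≤
      algebraicClasses (⨁ fun j : Fin 1 => A ((fun _ : Fin 1 => m.succ) j)).X 2 :=
    (weilClassesPlus_le_span_singleton hΛ hb₁ hd hφ (hline_plus hbu) (b.ne_zero u)).trans
      ((Submodule.span_singleton_le_iff_mem _ _).2 (hline_alg hbu))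
  exact weilClassesOf_le_algebraicClasses_of_weilClassesPlus_le hplus

/-- **ENGINE INPUT — an OCTIC `(2,2)`-slot (`n = 4`, two members over `τ` read at `{0, 1}`, `c = 0`, `w = 2`): the Weil plane of the part `⨁_i A(partSlots 0 m i) =
⨁_{Fin 1} B_m` from Markman's FOURFOLD theorem** — the hypothesis `hW m` of `MultiFieldWeil.hodgeConjectureFor_biproduct_comp_of_defectLawG` for such a slot.
[cite: Markman2025SurveySecant, Thm. 1.2 and §1.1] [cite: vanGeemen1994HodgeAV, 4.9–4.10] -/
theorem weilHyp_of_markman_fourfold22 (hW4 : Markman2025_weilClasses_algebraic_abelianFourfold) (m : Fin r)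
    (h8 : Module.finrank ℚ (Kf (is m)) = 8) (h2 : Module.finrank ℚ (Kf i₀) = 2) (hd : 0 < d) (hδ : ((δ : Kf i₀)) ^ 2 = -(d : Kf i₀))
    (hA : ∀ j, IsCMTypeRealisation (Φ j) (A j) (ι j) (θ j))
    (e₂ : (Kf (is m) →+* ℂ) ≃ Fin 4 × Bool) (he_sign : ∀ s, (e₂ s).2 = true ↔ s.comp (im m) = τ)
    (hΦm : ∀ s : Kf (is m) →+* ℂ, s ∈ (Φ m.succ).1 ↔ (e₂ s).2 = decide ((e₂ s).1 = 0 ∨ (e₂ s).1 = 1)) :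
    weilClassesOf (⨁ fun i => A (partSlots 0 m i)) (biproduct.map fun i => ι (partSlots 0 m i) (δfam im δ (partSlots 0 m i))) 2 d ≤
      algebraicClasses (⨁ fun i => A (partSlots 0 m i)).X 2 := by
  have hP : ((Finset.univ : Finset (Fin 4)).filter fun a => (fun (_ : Fin 1) (a : Fin 4) => decide (a = 0 ∨ a = 1)) 0 a = true).card = 2 := by
    decide
  have hcount : ∀ τ' : Kf i₀ →+* ℂ,
      (Finset.univ.filter fun s : Kf (is m) →+* ℂ => s.comp (im m) = τ' ∧ s ∈ (Φ m.succ).1).card = 2 := fun τ' =>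
    typeCount_eq_two_of_frameO (P := fun (_ : Fin 1) (a : Fin 4) => decide (a = 0 ∨ a = 1)) (m := 0) h2 he_sign hP hΦm τ'
  have hf : (fun _ : Fin 1 => m.succ) = partSlots 0 m := by
    funext j
    exact Fin.cases rfl (fun j => j.elim0) j
  exact weilHyp_transport hf (weilClassesOf_one_le_algebraicClasses_of_markman22 hW4 m h8 h2 hd hδ hA hcount)

end Summit.HodgeConjecture.CorCM.MultiFieldWeil

end
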